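/-
Copyright: the b2b-balaban T⁴-continuum CRUX team, row NE7b OWNER lineage `t4-ne7b-p1` (gen 129). Project licence.
-/
import Summits.QuantumFields.BalabanUV.T4Continuum.Spine.NE7b.SupAllFieldAssembly
import Summits.QuantumFields.BalabanUV.T4Continuum.Spine.NE7b.SupMarginSchedule
import Literature.Barriers.CriticalPhenomena.RigorousRGSmallParameterGaussianIntegration
import Mathlib.MeasureTheory.Group.IntegralConvolution

/-!
# THE ITERATION OF THE STEP IS THE GAUSSIAN SEMIGROUP: integrating the external field of one fluctuation step over the next scale gives the
# step with the SUMMED covariance — `∫ Z^{Γ₁}_{ξ+ψ}(C) dN(0,Γ₂)(ξ) = Z^{Γ₁+Γ₂}_ψ(C)` (`N(0,Γ₂) ∗ N(0,Γ₁) = N(0,Γ₁+Γ₂)` + Fubini) — so along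
# (280)'s scales the `n`-fold composition of steps IS one step with `Σ_{j<n}Γ_j`, and every hypothesis of the one-scale theorems
# ((306)∕(307)) is inherited by the sum; with (303)'s GEOMETRIC schedule `Γ_j ⪯ (K₀∕4^j)·1` the operator and diagonal bounds of the sum are
# `(4∕3)K₀` for EVERY `n`, hence the small-field gas and the all-field assembly of the composed step hold with constants INDEPENDENT of the
# number of scales (row NE7b, node U5c; the tree's `multivariateGaussian_conv_multivariateGaussian`, Mathlib's `integral_conv`,
# `Matrix.posSemidef_sum`, the tree's `HasFiniteRange.sum`, (303)'s `geom_quarter_sum_le`, (306)∕(307) BY NAME; [folklore])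

Cell `pub-balaban`, sub-cell `t4`, spine estimate NE7b (`T4WeightBudget.RelWeightBound`; the cell's OWN estimate — NOT PRINTED in
[Bałaban 1983–89], NOT PROVED).  Crux-route work under `Spine/NE7b/` by the row OWNER (`t4-ne7b-p1` gen 129, file (310)) under FREEZE
(0)'s crux-prover clause, on § [NE7bP1-G128-HANDOFF] NEXT (3)(c) («the ITERATION: carry the class along (280)'s convolution of scales»);
NOTHING of Bałaban's is named as a Lean object, valued or asserted; no `T4Continuum/Support` leaf typed; no `def`, no notation; zero `sorry`.
Imports (BY NAME): the OWNER's (307) `…SupAllFieldAssembly` (`log_integral_allField_le`), (306) (`abs_log_integral_smallField_le`), (297)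
(`integrable_exp_neg`), (303) `…SupMarginSchedule` (`geom_quarter_sum_le`, `one_div_four_pow`); the tree's
`Literature/Barriers/CriticalPhenomena/RigorousRGSmallParameterGaussianIntegration` (`LongRangePhi4.multivariateGaussian_conv_multivariateGaussian`),
`Literature/Analysis/Matrix/FiniteRangeDecomposition` (`HasFiniteRange.sum`); Mathlib's `MeasureTheory.integral_conv`, `Matrix.posSemidef_sum`,
`Matrix.PosSemidef.smul`, `Matrix.PosSemidef.one`, `Matrix.PosSemidef.diag_nonneg`.

WHY (located; HONEST about (c)).  In the scalar road WITHOUT re-blocking or renormalisation of the regulator, a fluctuation step is a FIXED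
functional of the external field, and composing steps along (280)'s scale decomposition is exactly the Gaussian semigroup: nothing is
re-expanded, and the composed step is the one-scale step for the summed covariance.  The content of «iteration» at this level is therefore
UNIFORMITY: the one-scale hypotheses (positivity, operator∕diagonal bounds, finite range) pass to finite sums of scales, and under the geometric
schedule of (303) the bounds do not grow with the number of scales — so (306)'s `O(ε)` gas bound and (307)'s all-field assembly hold for the
composed step with `n`-independent constants.  (The regulator side of the same statement is (301)–(303).)

WHAT IS PROVED ([folklore]):
* §1 THE SEMIGROUP: **`integral_integral_shift_eq`** (`Γ₁, Γ₂ ⪰ 0`, `F` integrable for `N(0,Γ₁+Γ₂)` ⟹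
  `∫∫F(ω+ξ)dN(0,Γ₁)(ω)dN(0,Γ₂)(ξ) = ∫F dN(0,Γ₁+Γ₂)`), **`step_step_eq_step_sum`** (the road's step: `∫ Z^{Γ₁}_{ξ+ψ}(C) dN(0,Γ₂)(ξ) = Z^{Γ₁+Γ₂}_ψ(C)`,
  stable measurable remainders, `2κ₀(1+τ)γ_op ≤ θ < 1` for the sum);
* §2 SUMS OF SCALES INHERIT THE HYPOTHESES: `posSemidef_sum_scales`, `opBound_sum_scales` (`Γ_j ⪯ γ_j·1 ⟹ ΣΓ_j ⪯ (Σγ_j)·1`), `diag_le_of_opBound`,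
  `diag_sum_scales_le`, `hasFiniteRange_sum_scales`;
* §3 THE GEOMETRIC SCHEDULE: `sum_quarter_schedule_le` (`Σ_{j<n}K₀∕4^j ≤ (4∕3)K₀`), `opBound_geometric` (`Γ_j ⪯ (K₀∕4^j)·1 ⟹ Σ_{j<n}Γ_j ⪯ (4K₀∕3)·1`),
  `diag_geometric_le`;
* §4 THE END, UNIFORMLY IN THE NUMBER OF SCALES: **`smallField_composed_le`** ((306)'s `|log ∫e^{−A}| ≤ #S(Δ+1)2e·ε_ΨA^v` for the composed
  step `Σ_{j<n}Γ_j`, constants with `γ_op = γ = 4K₀∕3`, every `n`) and **`allField_composed_le`** ((307)'s UPPER bound for the composed step, every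
  `n`); §5 toy.

HONEST (what this is NOT).  No renormalisation-group MAP is iterated (no blocking, no rescaling of `κ`, no extraction of marginal∕relevant
parts — the genuinely multiscale content of Bałaban's method is absent from the scalar road at this level); the statement is the semigroup
bookkeeping and the `n`-uniformity of constants; scalar skeleton ((A3), NC-NE7b-α UNRULED); nothing of Bałaban's asserted.  BY-NAME EFFECT ON
THE WALL: NONE.  NE7b NOT PRINTED ∕ NOT PROVED; spine PROVED 0∕9; rung (B)+1 — the programme's measures remain FINITE-torus statements; NOT the
mass gap, NOT Clay.  HONEST DEPENDENCY: continuum YM on T⁴ ⇐ BetaPertH ∧ nine spine estimates (0∕9 proved); BetaPertH ⇐ (D1) ∧ (D4) ∧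
CAP+tail; G-an2-4 gates asym, D1 and NE2∕3∕4.
-/

set_option autoImplicit false

noncomputable section

namespace Summit.QuantumFields.BalabanUV.T4Continuum.NE7b.SupStepSemigroup

open MeasureTheory ProbabilityTheory Finset Real
open scoped BigOperators
open Literature.Analysis.Matrix (HasFiniteRange)
open Literature.Barriers.CriticalPhenomena.LongRangePhi4 (multivariateGaussian_conv_multivariateGaussian)
open SupAllFieldAssembly (log_integral_allField_le)
open SupSmallFieldGasReal (abs_log_integral_smallField_le measurable_cellSum)
open SupFluctuationAPriori (integrable_exp_neg)
open SupMarginSchedule (geom_quarter_sum_le one_div_four_pow)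

variable {ι : Type} [Fintype ι] [DecidableEq ι] {V : Type*} [DecidableEq V]

/-! ## §1. The semigroup of the step -/

/-- **THE GAUSSIAN SEMIGROUP ON INTEGRALS**: `Γ₁, Γ₂ ⪰ 0`, `F` integrable for `N(0,Γ₁+Γ₂)` ⟹
`∫ (∫ F(ω+ξ) dN(0,Γ₁)(ω)) dN(0,Γ₂)(ξ) = ∫ F dN(0,Γ₁+Γ₂)` (convolution of centred Gaussians adds covariances; Fubini). [folklore] -/
theorem integral_integral_shift_eq {Γ₁ Γ₂ : Matrix ι ι ℝ} (h₁ : Γ₁.PosSemidef) (h₂ : Γ₂.PosSemidef) (F : EuclideanSpace ℝ ι → ℝ)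
    (hF : Integrable F (multivariateGaussian 0 (Γ₁ + Γ₂))) :
    ∫ ξ, (∫ ω, F (ω + ξ) ∂(multivariateGaussian 0 Γ₁)) ∂(multivariateGaussian 0 Γ₂) = ∫ ζ, F ζ ∂(multivariateGaussian 0 (Γ₁ + Γ₂)) := by
  have hconv : multivariateGaussian 0 Γ₂ ∗ multivariateGaussian 0 Γ₁ = multivariateGaussian (0 : EuclideanSpace ℝ ι) (Γ₁ + Γ₂) := by
    rw [multivariateGaussian_conv_multivariateGaussian 0 0 h₂ h₁, add_zero, add_comm]
  have hF' : Integrable F (multivariateGaussian 0 Γ₂ ∗ multivariateGaussian 0 Γ₁) := by rw [hconv]; exact hF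
  rw [← hconv, integral_conv hF']
  refine integral_congr_ae (ae_of_all _ fun ξ => integral_congr_ae (ae_of_all _ fun ω => ?_))
  simp only [add_comm]

omit [DecidableEq V] in
/-- **THE STEP'S SEMIGROUP**: for stable measurable remainders (`w_x(t) ≥ −κ₀t²`, `κ₀ ≥ 0`), `Γ₁, Γ₂ ⪰ 0` with `Γ₁ + Γ₂ ⪯ γ_op·1`,
`0 < τ`, `2κ₀(1+τ)γ_op ≤ θ < 1`:
`∫ (∫ e^{−Σ_{p∈C}Σ_{x∈cell p}w_x(ω_x + (ξ+ψ)_x)} dN(0,Γ₁)(ω)) dN(0,Γ₂)(ξ) = ∫ e^{−Σ_{p∈C}Σ_{x∈cell p}w_x(ζ_x+ψ_x)} dN(0,Γ₁+Γ₂)(ζ)` —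
integrating the external field of a step over the next scale IS the step with the summed covariance. [folklore] -/
theorem step_step_eq_step_sum {Γ₁ Γ₂ : Matrix ι ι ℝ} {γop : ℝ} (h₁ : Γ₁.PosSemidef) (h₂ : Γ₂.PosSemidef)
    (hΓop : (γop • (1 : Matrix ι ι ℝ) - (Γ₁ + Γ₂)).PosSemidef) (cell : V → Finset ι)
    (hdisj : ∀ p q, p ≠ q → Disjoint (cell p) (cell q)) (w : ι → ℝ → ℝ) (hw : ∀ x, Measurable (w x))
    {κ₀ τ θ : ℝ} (hκ₀ : 0 ≤ κ₀) (hτ : 0 < τ) (hθ1 : θ < 1) (hκθ : 2 * κ₀ * (1 + τ) * γop ≤ θ)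
    (hstab : ∀ x, ∀ t : ℝ, -(κ₀ * t ^ 2) ≤ w x t) (C : Finset V) (ψ : EuclideanSpace ℝ ι) :
    ∫ ξ : EuclideanSpace ℝ ι, (∫ ω : EuclideanSpace ℝ ι, exp (-(∑ p ∈ C, ∑ x ∈ cell p, w x (ω x + (ξ + ψ) x)))
        ∂(multivariateGaussian 0 Γ₁)) ∂(multivariateGaussian 0 Γ₂) =
      ∫ ζ : EuclideanSpace ℝ ι, exp (-(∑ p ∈ C, ∑ x ∈ cell p, w x (ζ x + ψ x))) ∂(multivariateGaussian 0 (Γ₁ + Γ₂)) := by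
  have hint : Integrable (fun ζ : EuclideanSpace ℝ ι => exp (-(∑ p ∈ C, ∑ x ∈ cell p, w x (ζ x + ψ x))))
      (multivariateGaussian 0 (Γ₁ + Γ₂)) := by
    have h := integrable_exp_neg (h₁.add h₂) hΓop (C.biUnion cell) w hw hκ₀ hτ hθ1 hκθ hstab (fun x => ψ x)
    refine h.congr (ae_of_all _ fun ζ => ?_)
    simp only
    rw [SupSmallFieldGasReal.cellSum_eq_sum_biUnion cell hdisj C]
  rw [← integral_integral_shift_eq h₁ h₂ _ hint]
  refine integral_congr_ae (ae_of_all _ fun ξ => integral_congr_ae (ae_of_all _ fun ω => ?_))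
  simp only [WithLp.ofLp_add, Pi.add_apply, add_assoc]

/-! ## §2. Sums of scales inherit the one-scale hypotheses -/

omit [Fintype ι] [DecidableEq ι] in
/-- A finite sum of positive semidefinite scale covariances is positive semidefinite. [folklore] -/
theorem posSemidef_sum_scales (Γ : ℕ → Matrix ι ι ℝ) (s : Finset ℕ) (h : ∀ j ∈ s, (Γ j).PosSemidef) :
    (∑ j ∈ s, Γ j).PosSemidef :=
  Matrix.posSemidef_sum s h

omit [Fintype ι] in
/-- **Operator bounds add**: `Γ_j ⪯ γ_j·1` for `j ∈ s` ⟹ `Σ_{j∈s}Γ_j ⪯ (Σ_{j∈s}γ_j)·1`. [folklore] -/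
theorem opBound_sum_scales (Γ : ℕ → Matrix ι ι ℝ) (γ : ℕ → ℝ) (s : Finset ℕ)
    (h : ∀ j ∈ s, ((γ j) • (1 : Matrix ι ι ℝ) - Γ j).PosSemidef) :
    ((∑ j ∈ s, γ j) • (1 : Matrix ι ι ℝ) - ∑ j ∈ s, Γ j).PosSemidef := by
  have heq : (∑ j ∈ s, γ j) • (1 : Matrix ι ι ℝ) - ∑ j ∈ s, Γ j = ∑ j ∈ s, ((γ j) • (1 : Matrix ι ι ℝ) - Γ j) := by
    rw [sum_sub_distrib, sum_smul]
  rw [heq]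
  exact Matrix.posSemidef_sum s h

omit [Fintype ι] in
/-- **An operator bound bounds the diagonal**: `Γ ⪯ c·1 ⟹ Γ(i,i) ≤ c`. [folklore] -/
theorem diag_le_of_opBound {Γ : Matrix ι ι ℝ} {c : ℝ} (h : (c • (1 : Matrix ι ι ℝ) - Γ).PosSemidef) (i : ι) : Γ i i ≤ c := by
  have hd : 0 ≤ (c • (1 : Matrix ι ι ℝ) - Γ) i i := h.diag_nonneg
  simp only [Matrix.sub_apply, Matrix.smul_apply, Matrix.one_apply_eq, smul_eq_mul, mul_one] at hd
  linarith

omit [Fintype ι] [DecidableEq ι] in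
/-- **Diagonal bounds add**: `Γ_j(i,i) ≤ γ_j` for `j ∈ s` ⟹ `(Σ_{j∈s}Γ_j)(i,i) ≤ Σ_{j∈s}γ_j`. [folklore] -/
theorem diag_sum_scales_le (Γ : ℕ → Matrix ι ι ℝ) (γ : ℕ → ℝ) (s : Finset ℕ) (i : ι) (h : ∀ j ∈ s, Γ j i i ≤ γ j) :
    (∑ j ∈ s, Γ j) i i ≤ ∑ j ∈ s, γ j := by
  rw [Matrix.sum_apply]
  exact sum_le_sum h

omit [Fintype ι] [DecidableEq ι] in
/-- **Finite range is inherited by sums of scales** (the tree's `HasFiniteRange.sum`). [folklore] -/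
theorem hasFiniteRange_sum_scales {dι : ι → ι → ℕ} {ρ : ℕ} (Γ : ℕ → Matrix ι ι ℝ) (s : Finset ℕ)
    (h : ∀ j ∈ s, HasFiniteRange dι ρ (Γ j)) : HasFiniteRange dι ρ (∑ j ∈ s, Γ j) :=
  HasFiniteRange.sum s h

/-! ## §3. The geometric schedule: bounds independent of the number of scales -/

/-- `Σ_{j<n} K₀∕4^j ≤ (4∕3)K₀` for `K₀ ≥ 0`. [folklore] -/
theorem sum_quarter_schedule_le {K₀ : ℝ} (hK : 0 ≤ K₀) (n : ℕ) : ∑ j ∈ range n, K₀ / 4 ^ j ≤ 4 / 3 * K₀ := by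
  have h := geom_quarter_sum_le n
  have heq : ∑ j ∈ range n, K₀ / 4 ^ j = K₀ * ∑ j ∈ range n, ((1 : ℝ) / 4) ^ j := by
    rw [mul_sum]
    refine sum_congr rfl fun j _ => ?_
    rw [← one_div_four_pow, mul_one_div]
  rw [heq]
  nlinarith

omit [Fintype ι] in
/-- **THE OPERATOR BOUND OF THE COMPOSED SCALES IS `4K₀∕3` FOR EVERY `n`**: `Γ_j ⪯ (K₀∕4^j)·1` (`K₀ ≥ 0`) ⟹ `Σ_{j<n}Γ_j ⪯ (4K₀∕3)·1`. [folklore] -/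
theorem opBound_geometric (Γ : ℕ → Matrix ι ι ℝ) {K₀ : ℝ} (hK : 0 ≤ K₀)
    (h : ∀ j, ((K₀ / 4 ^ j) • (1 : Matrix ι ι ℝ) - Γ j).PosSemidef) (n : ℕ) :
    ((4 / 3 * K₀) • (1 : Matrix ι ι ℝ) - ∑ j ∈ range n, Γ j).PosSemidef := by
  have hsum := opBound_sum_scales Γ (fun j => K₀ / 4 ^ j) (range n) fun j _ => h j
  have hle := sum_quarter_schedule_le hK n
  have heq : (4 / 3 * K₀) • (1 : Matrix ι ι ℝ) - ∑ j ∈ range n, Γ j =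
      (4 / 3 * K₀ - ∑ j ∈ range n, K₀ / 4 ^ j) • (1 : Matrix ι ι ℝ) +
        ((∑ j ∈ range n, K₀ / 4 ^ j) • (1 : Matrix ι ι ℝ) - ∑ j ∈ range n, Γ j) := by
    rw [sub_smul]
    abel
  rw [heq]
  exact (Matrix.PosSemidef.one.smul (by linarith)).add hsum

omit [Fintype ι] in
/-- **THE DIAGONAL OF THE COMPOSED SCALES IS `≤ 4K₀∕3` FOR EVERY `n`** under the same schedule. [folklore] -/
theorem diag_geometric_le (Γ : ℕ → Matrix ι ι ℝ) {K₀ : ℝ} (hK : 0 ≤ K₀)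
    (h : ∀ j, ((K₀ / 4 ^ j) • (1 : Matrix ι ι ℝ) - Γ j).PosSemidef) (n : ℕ) (i : ι) :
    (∑ j ∈ range n, Γ j) i i ≤ 4 / 3 * K₀ :=
  (diag_sum_scales_le Γ (fun j => K₀ / 4 ^ j) (range n) i fun j _ => diag_le_of_opBound (h j) i).trans
    (sum_quarter_schedule_le hK n)

/-! ## §4. THE END: the composed step is controlled uniformly in the number of scales -/

section Composed

variable {dι : ι → ι → ℕ} {ρ : ℕ} {cell : V → Finset ι} {v : ℕ} {R : V → V → Prop} [DecidableRel R] [Std.Symm R]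
  {nbr : V → Finset V} {Δ : ℕ} {w : ι → ℝ → ℝ} {κ₀ c₃ h κ τ θ Ψ K₀ : ℝ}

/-- **THE SMALL-FIELD GAS OF THE COMPOSED STEP, UNIFORMLY IN `n`.**  Scales `Γ_j ⪰ 0` of range `ρ` with the geometric schedule
`Γ_j ⪯ (K₀∕4^j)·1` (`K₀ ≥ 0`); disjoint cells of `≤ v` sites; `R` symmetric covering `ρ`-closeness with `≤ Δ` neighbours; stable (`κ₀`) and
cubically small (`c₃` on `|t| ≤ h`) measurable remainders; `2κ₀ ≤ κ`, `0 < τ`, `0 < θ < 1`, `κ(1+τ)(4K₀∕3) ≤ θ`; `ψ` small on the cells of `S`;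
`e·ε_Ψ(h)A^v(Δ+1)² ≤ 1∕2` with `A = (1−θ)^{−κ(1+τ)(4K₀∕3)∕(2θ)}` ⟹ for EVERY `n`:
`|log ∫e^{−Σ_{p∈S}Σ_{x∈cell p}w_x(ζ_x+ψ_x)} dN(0,Σ_{j<n}Γ_j)| ≤ #S·(Δ+1)·2e·ε_Ψ(h)A^v` — the composed step over `n` scales, `n`-independent
constants. [folklore] -/
theorem smallField_composed_le (Γ : ℕ → Matrix ι ι ℝ) (hΓ : ∀ j, (Γ j).PosSemidef) (hK : 0 ≤ K₀)
    (hop : ∀ j, ((K₀ / 4 ^ j) • (1 : Matrix ι ι ℝ) - Γ j).PosSemidef) (hfr : ∀ j, HasFiniteRange dι ρ (Γ j))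
    (hdisj : ∀ p q, p ≠ q → Disjoint (cell p) (cell q)) (hv : ∀ p, (cell p).card ≤ v)
    (hR : ∀ (p p' : V) (x y : ι), x ∈ cell p → y ∈ cell p' → dι x y ≤ ρ → p = p' ∨ R p p')
    (hΔ : ∀ x, (nbr x).card ≤ Δ) (hnbr : ∀ x y, R x y → y ∈ nbr x) (hw : ∀ x, Measurable (w x)) (hκ₀ : 0 ≤ κ₀) (hc₃ : 0 ≤ c₃)
    (hh : 0 ≤ h) (hstab : ∀ x, ∀ t : ℝ, -(κ₀ * t ^ 2) ≤ w x t) (hcub : ∀ x, ∀ t : ℝ, |t| ≤ h → |w x t| ≤ c₃ * |t| ^ 3)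
    (hκ : 2 * κ₀ ≤ κ) (hτ : 0 < τ) (hθ0 : 0 < θ) (hθ1 : θ < 1) (hκθ : κ * (1 + τ) * (4 / 3 * K₀) ≤ θ) (S : Finset V)
    (ψ : EuclideanSpace ℝ ι) (hψ : ∀ p ∈ S, ∑ x ∈ cell p, ψ x ^ 2 ≤ Ψ ^ 2)
    (hsmall : Real.exp 1 * (((max (exp (c₃ * v * h ^ 3) - 1) (2 * exp (-((κ / 2 - κ₀) * h ^ 2)))) *
      exp (κ * (1 + τ⁻¹) * Ψ ^ 2 / 2)) * ((1 - θ) ^ (-(κ * (1 + τ) * (4 / 3 * K₀) / (2 * θ)))) ^ v) * ((Δ : ℝ) + 1) ^ 2 ≤ 1 / 2)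
    (n : ℕ) :
    |log (∫ ζ : EuclideanSpace ℝ ι, exp (-(∑ p ∈ S, ∑ x ∈ cell p, w x (ζ x + ψ x))) ∂(multivariateGaussian 0 (∑ j ∈ range n, Γ j)))| ≤
      S.card * ((Δ : ℝ) + 1) * (2 * (Real.exp 1 * (((max (exp (c₃ * v * h ^ 3) - 1) (2 * exp (-((κ / 2 - κ₀) * h ^ 2)))) *
        exp (κ * (1 + τ⁻¹) * Ψ ^ 2 / 2)) * ((1 - θ) ^ (-(κ * (1 + τ) * (4 / 3 * K₀) / (2 * θ)))) ^ v))) :=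
  abs_log_integral_smallField_le (posSemidef_sum_scales Γ (range n) fun j _ => hΓ j) (opBound_geometric Γ hK hop n)
    (diag_geometric_le Γ hK hop n) (by positivity) (hasFiniteRange_sum_scales Γ (range n) fun j _ => hfr j) cell hdisj hv hR hΔ hnbr w hw
    hκ₀ hc₃ hh hstab hcub hκ hτ hθ0 hθ1 hκθ S ψ hψ hsmall

/-- **THE ALL-FIELD ASSEMBLY OF THE COMPOSED STEP, UNIFORMLY IN `n`** ((307)'s UPPER bound for `N(0,Σ_{j<n}Γ_j)` under the geometric
schedule; every constant independent of `n`): for `S, L` disjoint with `ψ` small on the cells of `S` only, `4κ₀ ≤ κ`, `κ(1+τ)(4K₀∕3) ≤ θ < 1`,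
`e·ε₂A^v(Δ+1)² ≤ 1∕2` ⟹
`log ∫e^{−Σ_{p∈S∪L}Σ_{x∈cell p}w_x(ζ_x+ψ_x)} dN(0,Σ_{j<n}Γ_j) ≤ ½·#S(Δ+1)2e·ε₂A^v + ½·(#Y_L·(4κ₀(1+τ)(4K₀∕3)∕(2θ))(−log(1−θ)) + 2κ₀(1+τ⁻¹)Σ_{Y_L}ψ²)`.
[folklore] -/
theorem allField_composed_le (Γ : ℕ → Matrix ι ι ℝ) (hΓ : ∀ j, (Γ j).PosSemidef) (hK : 0 ≤ K₀)
    (hop : ∀ j, ((K₀ / 4 ^ j) • (1 : Matrix ι ι ℝ) - Γ j).PosSemidef) (hfr : ∀ j, HasFiniteRange dι ρ (Γ j))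
    (hdisj : ∀ p q, p ≠ q → Disjoint (cell p) (cell q)) (hv : ∀ p, (cell p).card ≤ v)
    (hR : ∀ (p p' : V) (x y : ι), x ∈ cell p → y ∈ cell p' → dι x y ≤ ρ → p = p' ∨ R p p')
    (hΔ : ∀ x, (nbr x).card ≤ Δ) (hnbr : ∀ x y, R x y → y ∈ nbr x) (hw : ∀ x, Measurable (w x)) (hκ₀ : 0 ≤ κ₀) (hc₃ : 0 ≤ c₃)
    (hh : 0 ≤ h) (hstab : ∀ x, ∀ t : ℝ, -(κ₀ * t ^ 2) ≤ w x t) (hcub : ∀ x, ∀ t : ℝ, |t| ≤ h → |w x t| ≤ c₃ * |t| ^ 3)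
    (hκ : 4 * κ₀ ≤ κ) (hτ : 0 < τ) (hθ0 : 0 < θ) (hθ1 : θ < 1) (hκθ : κ * (1 + τ) * (4 / 3 * K₀) ≤ θ) (S L : Finset V)
    (hSL : Disjoint S L) (ψ : EuclideanSpace ℝ ι) (hψ : ∀ p ∈ S, ∑ x ∈ cell p, ψ x ^ 2 ≤ Ψ ^ 2)
    (hsmall₂ : Real.exp 1 * (((max (exp (2 * c₃ * v * h ^ 3) - 1) (2 * exp (-((κ / 2 - 2 * κ₀) * h ^ 2)))) *
      exp (κ * (1 + τ⁻¹) * Ψ ^ 2 / 2)) * ((1 - θ) ^ (-(κ * (1 + τ) * (4 / 3 * K₀) / (2 * θ)))) ^ v) * ((Δ : ℝ) + 1) ^ 2 ≤ 1 / 2)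
    (n : ℕ) :
    log (∫ ζ : EuclideanSpace ℝ ι, exp (-(∑ p ∈ S ∪ L, ∑ x ∈ cell p, w x (ζ x + ψ x))) ∂(multivariateGaussian 0 (∑ j ∈ range n, Γ j))) ≤
      (1 / 2) * (S.card * ((Δ : ℝ) + 1) * (2 * (Real.exp 1 * (((max (exp (2 * c₃ * v * h ^ 3) - 1)
        (2 * exp (-((κ / 2 - 2 * κ₀) * h ^ 2)))) * exp (κ * (1 + τ⁻¹) * Ψ ^ 2 / 2)) *
        ((1 - θ) ^ (-(κ * (1 + τ) * (4 / 3 * K₀) / (2 * θ)))) ^ v)))) +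
      (1 / 2) * ((L.biUnion cell).card * (2 * (2 * κ₀) * (1 + τ) * (4 / 3 * K₀) / (2 * θ)) * (-log (1 - θ)) +
        2 * κ₀ * (1 + τ⁻¹) * ∑ x ∈ L.biUnion cell, ψ x ^ 2) :=
  log_integral_allField_le (posSemidef_sum_scales Γ (range n) fun j _ => hΓ j) (opBound_geometric Γ hK hop n)
    (diag_geometric_le Γ hK hop n) (by positivity) (hasFiniteRange_sum_scales Γ (range n) fun j _ => hfr j) hdisj hv hR hΔ hnbr hw hκ₀
    hc₃ hh hstab hcub hκ hτ hθ0 hθ1 hκθ S L hSL ψ hψ hsmall₂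

end Composed

/-! ## §5. Toy -/

/-- Toy (§3): with NO scales (`n = 0`) the composed covariance is `0 ⪯ (4K₀∕3)·1`. -/
example (Γ : ℕ → Matrix (Fin 1) (Fin 1) ℝ) (h : ∀ j, (((1 : ℝ) / 4 ^ j) • (1 : Matrix (Fin 1) (Fin 1) ℝ) - Γ j).PosSemidef) :
    ((4 / 3 * (1 : ℝ)) • (1 : Matrix (Fin 1) (Fin 1) ℝ) - ∑ j ∈ range 0, Γ j).PosSemidef :=
  opBound_geometric Γ zero_le_one h 0

end Summit.QuantumFields.BalabanUV.T4Continuum.NE7b.SupStepSemigroup
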